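import Summits.QuantumFields.YangMills.Theorems.BalabanUVNodesN09AxialCovariance181
import Literature.MathematicalPhysics.QuantumFieldTheory.Balaban1983to89.Node00.SmallFieldChi29SelOfRecord

/-!
# NODE N09 — PRINT'S OBJECT (2.3) EXISTS AT THE RECORD'S LETTERS: a MEASURABLE, FIBRE-PRESERVING, BLOCK-AXIAL and (181)ˢᵒˡ-COVARIANT critical configuration
# `W ↦ V^{(k)}(W)` over the (0.21) problem of record — the measurable block-axial normal form of `T^{(k)}` (this seat's FILE 5) composed with dag-n09-w4's measurable
# rooted selection `critCfgSelOfRecord` (`Node00.SmallFieldChi29SelOfRecord`)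

TRACK A (YM-PLAN §2d, node N09 of 28), seat `pub-ymgap-dag-n09-w2` (D-0149 width seat 2∕4), generation g2, FILE 9.  Key of record: K1⁷ `StabilityBAtRecordR13SepCoPH` =
stmt-QuantumFields-20542; `--supports` it as a helper (Summits lane).  [I] = [Balaban1987RG1] (CMP 109), [B11] = [Balaban1985Variational] (CMP 102), [B8] =
[Balaban1985RegularSpaces] (CMP 99).

WHY.  Two re-point routes for N09's selection binders are on node00-def's table: dag-n09-w4's MEASURABLE rooted selection `UkSel` ∕ `critCfgSelOfRecord` (Literature; (H-U) and
(181)ˢᵒˡ on the [B11] domain as theorems, NOT block-axial at level `k`) and this seat's AXIAL route (FILES 5–8: print's (2.3) «in the axial gauge» + [B11] uniqueness; existence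
by choice in FILE 8, no measurability).  THIS FILE knits them: the EXPLICIT fine axial-gauging element of FILE 5 (`u_V(x) = V(Γ_{y(x),x})` off the centres, `1` on them) is
MEASURABLE in `V` whenever the contour variables are (any `[RegularGaugeGroup G]`; for def-B's `contourOfRecord` by r09's `B12FaddeevPopov016TwoLevel.measurable_holTo` at
Federbush's mean), so a MEASURABLE block-axial normal form `ax` exists; and `ax ∘ critCfgSelOfRecord` is then measurable (w4), in the fibre (`M(ax V) = M(V)`), block-axial
(§1), and block-lift covariant on `{UkExists ∧ UniqueUkOrbit}` (FILE 5 `ax_iter_sel_gaugeAct` at `sel := UkSel`, w4's `isBackground_UkSel`) — i.e. an object with EVERY property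
print uses of `V^{(k)}(W)` in (2.1)–(2.10) exists over NODE 00's definitions, from [B11] Thm 1's clauses alone.
* §1 (generic `G`, `[MeasurableSpace G] [RegularGaugeGroup G]`, any `cd` with measurable contour variables) `measurable_fineAxialElement_apply`, `measurable_gaugeAct_of_apply`
  (a field-dependent gauge transformation acts measurably), ★ `exists_measurable_axialNormalForm` (∃ `ax`: fine-related, axial, MEASURABLE).
* §2 (record) `measurable_holTo_contourOfRecord`, ★ `exists_measurable_axialNormalForm_contourOfRecord`, ★★ `exists_measurable_axial_covariant_critCfg` — for `k + 1 ≤ m + K`: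
  `∃ crit`, `Measurable crit` ∧ `M(crit W) = W` on the solvable set ∧ `AxialGauge (contourOfRecord F N K k) (crit W)` for every `W` ∧
  `crit (W^v) = (crit W)^{v∘blockOf}` whenever `UkExists … W ∧ UniqueUkOrbit … W` (radius `ν.εreg`).
LOCATED (not settled here): adopting such a `crit` for `critCfgOfRecord` is a RECORD EDITION (K0e ∕ def-T); the kit for it is w4's `UkSel` (Literature) + an importable `axialRep`
def (on request); nothing re-pointed here.

HONEST FRAMING: kernel measurability + gauge algebra over NODE 00's definitions and dag-n09-w4's Literature offer; NOTHING of Bałaban's asserted ([B11] Thm 1 only as hypotheses);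
N09 NOT discharged; K0⁷ ∕ K1⁷ OPEN; counts unmoved (typed 28∕28 · discharged 5∕27); R4 is the conditional finite-𝕋⁴ rung `BalabanLadder.UV` only — NOT continuum ∕ ℝ⁴ ∕ OS ∕
mass gap ∕ Clay.  THEOREMS ONLY (0 `def`, 0 `sorry`), standard axioms.
-/

noncomputable section

namespace Summit.QuantumFields.YangMills.BalabanUVNodes.N09MeasurableAxialCritCfg

open MeasureTheory
open Literature.MathematicalPhysics.QuantumFieldTheory.Balaban1983to89
open Literature.MathematicalPhysics.QuantumFieldTheory.Balaban1983to89.Node00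
open B12RTGaugeInvariance254 (liftTransf)
open GaugeField (gaugeAct)
open Summit.QuantumFields.YangMills.BalabanUVNodes.N09LiftInvariance29AtRecord (gaugeAct_mem_bgReg ukExists_gaugeAct_iff)
open Summit.QuantumFields.YangMills.BalabanUVNodes.N09AxialCovariance181 (ax_iter_sel_gaugeAct avg_ax_eq uniqueUkOrbit_gaugeAct_iff)

/-! ## §1. Generic regular gauge group: the explicit fine axial-gauging element is measurable; a measurable block-axial normal form exists -/

section Generic

variable {P : Params} {j : ℕ} {G : Type*} [GaugeGroup G] [MeasurableSpace G] [RegularGaugeGroup G]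

omit [RegularGaugeGroup G] in
/-- The explicit fine axial-gauging element of FILE 5 (`u_V(x) = 1` at a centre, `= V(Γ_{y(x),x})` otherwise) is MEASURABLE in `V` at every site, as soon as the contour
variables `V ↦ V(Γ_{y,x})` are. [cite: Balaban1985RegularSpaces, (1.15) p.78 (bookkeeping); Balaban1987RG1, (0.11) p.253] -/
theorem measurable_fineAxialElement_apply (cd : ContourData P j G) (hcd : ∀ (y : Site P (j + 1)) (x : Site P j), Measurable fun V : GaugeField P j G => cd.holTo V y x)
    (x : Site P j) :
    Measurable fun V : GaugeField P j G => (if x = emb (blockOf x) then (1 : G) else cd.holTo V (blockOf x) x) := by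
  by_cases hx : x = emb (blockOf x)
  · simp only [if_pos hx]
    exact measurable_const
  · simp only [if_neg hx]
    exact hcd (blockOf x) x

/-- A FIELD-DEPENDENT gauge transformation acts measurably: if `V ↦ u_V(x)` is measurable for every site, so is `V ↦ V^{u_V}` (bondwise products and inverses in a
`RegularGaugeGroup`). [cite: Balaban1985Averaging, (8) p.19 (bookkeeping)] -/
theorem measurable_gaugeAct_of_apply {u : GaugeField P j G → GaugeTransf P j G} (hu : ∀ x : Site P j, Measurable fun V => u V x) :
    Measurable fun V : GaugeField P j G => gaugeAct (u V) V := by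
  refine measurable_pi_lambda _ fun b => ?_
  have hb : Measurable fun V : GaugeField P j G => V b := measurable_pi_apply b
  exact ((hu b.src).mul hb).mul (hu b.tgt).inv

/-- ★ **A MEASURABLE BLOCK-AXIAL NORMAL FORM EXISTS** for every contour system with measurable contour variables (standing range `j + 1 ≤ m + K`): a map `ax` with
`ax V = V^u`, `u` fine, `ax V` axial for every `V` (FILE 5's explicit element, `exists_fine_axialGauge`'s proof term), and `Measurable ax`.
[cite: Balaban1985RegularSpaces, (1.15) p.78; Balaban1987RG1, (2.3) p.265] -/
theorem exists_measurable_axialNormalForm (hj : j + 1 ≤ P.m + P.K) (cd : ContourData P j G)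
    (hcd : ∀ (y : Site P (j + 1)) (x : Site P j), Measurable fun V : GaugeField P j G => cd.holTo V y x) :
    ∃ ax : GaugeField P j G → GaugeField P j G,
      (∀ V, ∃ u : GaugeTransf P j G, (∀ y : Site P (j + 1), u (emb y) = 1) ∧ ax V = gaugeAct u V) ∧ (∀ V, AxialGauge cd (ax V)) ∧ Measurable ax := by
  classical
  refine ⟨fun V => gaugeAct (fun x => if x = emb (blockOf x) then (1 : G) else cd.holTo V (blockOf x) x) V, fun V => ⟨_, fun y => ?_, rfl⟩, fun V y x hxy hx => ?_,
    measurable_gaugeAct_of_apply fun x => measurable_fineAxialElement_apply cd hcd x⟩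
  · have h : emb y = emb (blockOf (emb y)) := by rw [Site.blockOf_emb hj y]
    show (if emb y = emb (blockOf (emb y)) then (1 : G) else cd.holTo V (blockOf (emb y)) (emb y)) = 1
    rw [if_pos h]
  · subst hxy
    have h : emb (blockOf x) = emb (blockOf (emb (blockOf x))) := by rw [Site.blockOf_emb hj (blockOf x)]
    rw [cd.covariant]
    show (if emb (blockOf x) = emb (blockOf (emb (blockOf x))) then (1 : G) else cd.holTo V (blockOf (emb (blockOf x))) (emb (blockOf x))) *
        cd.holTo V (blockOf x) x * (if x = emb (blockOf x) then (1 : G) else cd.holTo V (blockOf x) x)⁻¹ = 1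
    rw [if_pos h, if_neg hx, one_mul, mul_inv_cancel]

end Generic

/-! ## §2. The record: def-B's contour variables are measurable; a measurable, block-axial, covariant critical configuration exists -/

variable {F : T4Continuum.T4Family} {N : ℕ} [NeZero N]

/-- def-B's averaged contour variables of record `U(y,x)` ((0.11) with Federbush's mean (0.10)) are measurable in `U` (r09 `B12FaddeevPopov016TwoLevel.measurable_holTo` at
`FederbushMean.federbushSU_measurable`, as in dag-n09-a's `measurable_gfOfRecord`). [cite: Balaban1987RG1, (0.10)–(0.11) p.253] -/
theorem measurable_holTo_contourOfRecord (K k : ℕ) (y : Site (F.P K) (k + 1)) (x : Site (F.P K) k) :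
    Measurable fun V : GaugeField (F.P K) k (SU N) => (contourOfRecord F N K k).holTo V y x :=
  B12FaddeevPopov016TwoLevel.measurable_holTo _ FederbushMean.federbushSU_measurable y x

/-- ★ A MEASURABLE block-axial normal form of `T^{(k)}` for def-B's contour system of record exists (`k + 1 ≤ m + K`). [cite: Balaban1985RegularSpaces, (1.15) p.78; Balaban1987RG1, (0.11) p.253] -/
theorem exists_measurable_axialNormalForm_contourOfRecord {K k : ℕ} (hk : k + 1 ≤ (F.P K).m + (F.P K).K) :
    ∃ ax : GaugeField (F.P K) k (SU N) → GaugeField (F.P K) k (SU N),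
      (∀ V, ∃ u : GaugeTransf (F.P K) k (SU N), (∀ y : Site (F.P K) (k + 1), u (emb y) = 1) ∧ ax V = gaugeAct u V) ∧
      (∀ V, AxialGauge (contourOfRecord F N K k) (ax V)) ∧ Measurable ax :=
  exists_measurable_axialNormalForm hk (contourOfRecord F N K k) (measurable_holTo_contourOfRecord K k)

/-- ★★ **PRINT'S `V^{(k)}(W)` EXISTS OVER THE (0.21) PROBLEM OF RECORD WITH EVERY PROPERTY (2.1)–(2.10) USE** (torus `K`, level `k`, `k + 1 ≤ m + K`, numerics `ν`): a map
`crit` on the level-`(k+1)` fields with — `Measurable crit` ((H-U) species); `M(crit W) = W` on the solvable set at radius `ν.εreg` ((2.3)–(2.4): in the fibre);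
`AxialGauge (contourOfRecord F N K k) (crit W)` for EVERY `W` ((2.2)–(2.3): «𝐆(V^{(k)}) = 0»); `crit (W^v) = (crit W)^{v∘blockOf}` whenever `UkExists … W ∧ UniqueUkOrbit … W`
((181)ˢᵒˡ, from [B11] Thm 1's uniqueness clause alone).  Witness: `ax ∘ critCfgSelOfRecord F N ν K k` — dag-n09-w4's measurable rooted selection composed with §2's measurable
block-axial normal form; covariance by FILE 5 `ax_iter_sel_gaugeAct` at `sel := UkSel … (k+1) ν.εreg` (w4's `isBackground_UkSel`), `uniqueUkOrbit_gaugeAct_iff`.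
[cite: Balaban1987RG1, (2.1)–(2.4) pp.265–266 and (2.9)–(2.10) pp.266–267; Balaban1985Variational, Thm 1 p.279 and (181) p.307] -/
theorem exists_measurable_axial_covariant_critCfg (ν : Stage7Numerics) {K k : ℕ} (hk : k + 1 ≤ (F.P K).m + (F.P K).K) :
    ∃ crit : GaugeField (F.P K) (k + 1) (SU N) → GaugeField (F.P K) k (SU N),
      Measurable crit ∧
      (∀ W, UkExists F N K (k + 1) ν.εreg W → (avOfRecord F N K k).avg (crit W) = W) ∧
      (∀ W, AxialGauge (contourOfRecord F N K k) (crit W)) ∧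
      ∀ (v : GaugeTransf (F.P K) (k + 1) (SU N)) (W : GaugeField (F.P K) (k + 1) (SU N)),
        UkExists F N K (k + 1) ν.εreg W → UniqueUkOrbit F N K (k + 1) ν.εreg W → crit (gaugeAct v W) = gaugeAct (liftTransf v) (crit W) := by
  obtain ⟨ax, hax₁, hax₂, haxm⟩ := exists_measurable_axialNormalForm_contourOfRecord (F := F) (N := N) hk
  refine ⟨fun W => ax (critCfgSelOfRecord F N ν K k W), haxm.comp (measurable_critCfgSelOfRecord ν K k), fun W hW => ?_, fun W => hax₂ _,
    fun v W hW huW => ?_⟩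
  · rw [avg_ax_eq hk (avOfRecord F N K k) hax₁, avg_critCfgSelOfRecord hk hW]
  · show ax (Averaging.iter (avOfRecord F N K) k (UkSel F N K (k + 1) ν.εreg (gaugeAct v W))) =
      gaugeAct (liftTransf v) (ax (Averaging.iter (avOfRecord F N K) k (UkSel F N K (k + 1) ν.εreg W)))
    exact ax_iter_sel_gaugeAct (av := avOfRecord F N K) (reg := bgReg F N K (k + 1) ν.εreg) (sel := UkSel F N K (k + 1) ν.εreg) hk
      (fun u U hU => gaugeAct_mem_bgReg u U hU) (contourOfRecord F N K k) hax₁ hax₂ (isBackground_UkSel hk hW)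
      (isBackground_UkSel hk ((ukExists_gaugeAct_iff hk ν.εreg v W).2 hW)) ((uniqueUkOrbit_gaugeAct_iff hk ν.εreg v W).2 huW)

end Summit.QuantumFields.YangMills.BalabanUVNodes.N09MeasurableAxialCritCfg
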